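import Summits.NavierStokesRegularity.NavierStokesRegularity.Theorems.SelfMixingDichotomyMixingPayoffAdvectionDiffusionStep
import Summits.NavierStokesRegularity.NavierStokesRegularity.Theorems.SelfMixingDichotomyMixingPayoffAdvectionDiffusionUnique
import HarnessLib

/-!
# Crux `MixingPayoff` (stmt-NavierStokesRegularity-1422), line `birth`, stub W2
  (`stub_advectionDiffusionSchwartz`): global smooth solutions of the linear equation
  `∂ₜψ = Δψ + ⟪β, ∇ψ⟫ + γψ` with `C_b^∞` coefficients from `C_b^∞` data

Helper file (lands `--supports stmt-NavierStokesRegularity-1422`). The windows of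
`linear_step` (`…AdvectionDiffusionStep`: one window length `T` for all restarts from a
bounded set of initial times, smooth solution on `[t₀, t₀ + T) × E` with uniform `Cⁿ` bounds of
the slices) are chained along `[a, b')`: consecutive windows overlap on a half window, where the
two solutions agree by the uniqueness of bounded classical solutions
(`eq_zero_of_linear_parabolic`, `…AdvectionDiffusionUnique`; here `slices_eq_of_solutions`),
so the glued function is locally one of the pieces — jointly `C^∞` on `[a, b') × E`, solving the
equation on `(a, b')`, bounded, with all slices bounded in every `Cⁿ` uniformly
(`linear_global`). This is the existence half of the Cauchy problem in `C_b^∞` for second-order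
parabolic equations with smooth bounded coefficients (Friedman 1964, Ch. 1 Thm. 12 with Ch. 3
Thm. 11 for the smooth case), obtained here from the tree's semigroup machinery.
-/

noncomputable section

open MeasureTheory Set Function Filter Metric Real
open _root_.Topology
open scoped ENNReal NNReal ContDiff Laplacian

-- `Summit = Problem` for this summit; the tree lakefile sets `weak.linter.dupNamespace = false`.
set_option linter.dupNamespace false

namespace Summit.NavierStokesRegularity.NavierStokesRegularity.Theorems.SelfMixingDichotomy.MixingPayoffBirth

open Literature.Analysis.UnboundedOperators Literature.Analysis.UnboundedOperators.HeatHolder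
open Literature.Analysis.FluidPDE Literature.Analysis.PDE.SemilinearHeat
open Literature.Analysis.Calculus (natCast_le_infty)


section Global

variable {E : Type} [NormedAddCommGroup E] [InnerProductSpace ℝ E] [FiniteDimensional ℝ E]
  [MeasurableSpace E] [BorelSpace E]
variable {β : ℝ → E → E} {γ : ℝ → E → ℝ}

omit [MeasurableSpace E] [BorelSpace E] in
/-- **Two solutions from the same slice agree** (the uniqueness theorem
`eq_zero_of_linear_parabolic` for the difference of two smooth bounded solutions with bounded
`C²` norms, on a common half-open window). -/
theorem slices_eq_of_solutions (hβb : ∀ n, ∃ C, ∀ p, ‖iteratedFDeriv ℝ n (uncurry β) p‖ ≤ C)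
    (hγb : ∀ n, ∃ C, ∀ p, ‖iteratedFDeriv ℝ n (uncurry γ) p‖ ≤ C)
    {ψ Θ : ℝ → E → ℝ} {s e : ℝ}
    (hψs : ContDiffOn ℝ ∞ (uncurry ψ) (Ico s e ×ˢ univ))
    (hΘs : ContDiffOn ℝ ∞ (uncurry Θ) (Ico s e ×ˢ univ))
    (hψeq : ∀ t ∈ Ioo s e, ∀ x, HasDerivAt (fun τ => ψ τ x)
      ((Δ (ψ t)) x + fderiv ℝ (ψ t) x (β t x) + γ t x * ψ t x) t)
    (hΘeq : ∀ t ∈ Ioo s e, ∀ x, HasDerivAt (fun τ => Θ τ x)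
      ((Δ (Θ t)) x + fderiv ℝ (Θ t) x (β t x) + γ t x * Θ t x) t)
    {M₁ M₂ A₁ A₂ : ℝ} (hψM : ∀ t ∈ Ico s e, ∀ x, |ψ t x| ≤ M₁) (hΘM : ∀ t ∈ Ico s e, ∀ x, |Θ t x| ≤ M₂)
    (hψ2 : ∀ t ∈ Ico s e, IsCkBounded 2 A₁ (ψ t)) (hΘ2 : ∀ t ∈ Ico s e, IsCkBounded 2 A₂ (Θ t))
    (h0 : ψ s = Θ s) : ∀ t ∈ Ico s e, ψ t = Θ t := by
  intro t ht
  rcases eq_or_lt_of_le ht.1 with h | hst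
  · rw [← h]; exact h0
  -- uniqueness on `[s, t]`
  obtain ⟨B, hB⟩ := hβb 0
  obtain ⟨G, hG⟩ := hγb 0
  have hβ' : ∀ τ ∈ Icc s t, ∀ x, ‖β τ x‖ ≤ B := fun τ _ x => by
    have := hB (τ, x); rwa [norm_iteratedFDeriv_zero] at this
  have hγ' : ∀ τ ∈ Icc s t, ∀ x, |γ τ x| ≤ G := fun τ _ x => by
    have := hG (τ, x); rwa [norm_iteratedFDeriv_zero, Real.norm_eq_abs] at this
  have hsub : Icc s t ⊆ Ico s e := Icc_subset_Ico_right ht.2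
  set w : ℝ → E → ℝ := fun τ x => ψ τ x - Θ τ x with hw
  have hwc : ContinuousOn (uncurry w) (Icc s t ×ˢ univ) :=
    (hψs.continuousOn.mono (prod_mono hsub Subset.rfl)).sub
      (hΘs.continuousOn.mono (prod_mono hsub Subset.rfl))
  have hw2 : ∀ τ ∈ Ioc s t, ContDiff ℝ 2 (w τ) := fun τ hτ =>
    (hψ2 τ (hsub ⟨hτ.1.le, hτ.2⟩)).contDiff.sub (hΘ2 τ (hsub ⟨hτ.1.le, hτ.2⟩)).contDiff
  have hwt : ∀ τ ∈ Ioc s t, ∀ x, HasDerivWithinAt (fun τ' => w τ' x)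
      ((Δ (w τ)) x + fderiv ℝ (w τ) x (β τ x) + γ τ x * w τ x) (Iic τ) τ := by
    intro τ hτ x
    have hτo : τ ∈ Ioo s e := ⟨hτ.1, hτ.2.trans_lt ht.2⟩
    have h := ((hψeq τ hτo x).sub (hΘeq τ hτo x)).hasDerivWithinAt (s := Iic τ)
    refine h.congr_deriv ?_
    have hτc : τ ∈ Ico s e := ⟨hτ.1.le, hτo.2⟩
    have hc1 : ContDiffAt ℝ 2 (ψ τ) x := (hψ2 τ hτc).contDiff.contDiffAt
    have hc2 : ContDiffAt ℝ 2 (Θ τ) x := (hΘ2 τ hτc).contDiff.contDiffAt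
    rw [show w τ = ψ τ - Θ τ from rfl, hc1.laplacian_sub hc2,
      fderiv_sub (hc1.differentiableAt (by norm_num)) (hc2.differentiableAt (by norm_num))]
    simp only [Pi.sub_apply, sub_apply]
    ring
  have hwb : ∀ τ ∈ Icc s t, ∀ x, |w τ x| ≤ M₁ + M₂ := fun τ hτ x => by
    have h1 := hψM τ (hsub hτ) x; have h2 := hΘM τ (hsub hτ) x
    simp only [hw]
    exact (abs_sub _ _).trans (add_le_add h1 h2)
  have hw0 : ∀ x, w s x = 0 := fun x => by simp [hw, h0]
  have hz := eq_zero_of_linear_parabolic hβ' hγ' hwc hw2 hwt hwb hw0 t ⟨hst.le, le_rfl⟩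
  funext x
  have := hz x
  simp only [hw] at this
  linarith

set_option maxHeartbeats 800000 in
/-- **Global smooth solutions of `∂ₜψ = Δψ + ⟪β, ∇ψ⟫ + γψ` with `C_b^∞` coefficients, from
`C_b^∞` data, on any bounded time interval.** For `β`, `γ` jointly `C^∞` on `ℝ × E` with all
derivatives bounded, `a < b'` and `ψ₀` with all derivatives bounded there is `ψ`, jointly `C^∞` on
`[a, b') × E`, solving the equation on `(a, b')`, with `ψ(a) = ψ₀`, bounded, and all slices
bounded in every `Cⁿ` uniformly on `[a, b')`. Proof: the windows of `linear_step` (one length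
for all restarts from `[-L, L]`, `L = |a| + |b'| + 2`) are chained; consecutive windows overlap
on a half window, where the two solutions agree by uniqueness (`slices_eq_of_solutions`), so the
glued function is locally one of them. -/
theorem linear_global (hβ : ContDiff ℝ ∞ (uncurry β)) (hγ : ContDiff ℝ ∞ (uncurry γ))
    (hβb : ∀ n, ∃ C, ∀ p, ‖iteratedFDeriv ℝ n (uncurry β) p‖ ≤ C)
    (hγb : ∀ n, ∃ C, ∀ p, ‖iteratedFDeriv ℝ n (uncurry γ) p‖ ≤ C) {a b' : ℝ} (hab : a < b')
    (ψ₀ : E → ℝ) (hψ₀ : ∀ n, ∃ A, IsCkBounded n A ψ₀) :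
    ∃ ψ : ℝ → E → ℝ, ψ a = ψ₀ ∧ ContDiffOn ℝ ∞ (uncurry ψ) (Ico a b' ×ˢ univ) ∧
      (∀ t ∈ Ioo a b', ∀ x, HasDerivAt (fun s => ψ s x)
        ((Δ (ψ t)) x + fderiv ℝ (ψ t) x (β t x) + γ t x * ψ t x) t) ∧
      (∃ M, ∀ t ∈ Ico a b', ∀ x, |ψ t x| ≤ M) ∧
      (∀ n, ∃ A, ∀ t ∈ Ico a b', IsCkBounded n A (ψ t)) := by
  set L : ℝ := |a| + |b'| + 2 with hL
  obtain ⟨T, hT0, hT1, hstep⟩ := linear_step hβ hγ hβb hγb L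
  set h : ℝ := T / 2 with hh
  have hh0 : 0 < h := by rw [hh]; linarith
  -- ### the chain of glued solutions
  have chain : ∀ k : ℕ, a + (k + 1) * h ≤ b' + 1 →
      ∃ ψ : ℝ → E → ℝ, ψ a = ψ₀ ∧
        ContDiffOn ℝ ∞ (uncurry ψ) (Ico a (a + (k + 2) * h) ×ˢ univ) ∧
        (∀ t ∈ Ioo a (a + (k + 2) * h), ∀ x, HasDerivAt (fun s => ψ s x)
          ((Δ (ψ t)) x + fderiv ℝ (ψ t) x (β t x) + γ t x * ψ t x) t) ∧
        (∃ M, ∀ t ∈ Ico a (a + (k + 2) * h), ∀ x, |ψ t x| ≤ M) ∧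
        (∀ n, ∃ A, ∀ t ∈ Ico a (a + (k + 2) * h), IsCkBounded n A (ψ t)) := by
    intro k
    induction k with
    | zero =>
      intro _
      have ha : a ∈ Icc (-L) L := by
        rw [hL]; constructor <;> linarith [abs_nonneg b', neg_abs_le a, le_abs_self a]
      obtain ⟨ψ, hψ0, hψs, hψeq, ⟨M, hM⟩, hψsl, -⟩ := hstep a ha ψ₀ hψ₀
      have he : a + (0 + 2) * h = a + T := by rw [hh]; ring
      simp only [Nat.cast_zero] at *
      rw [he]
      exact ⟨ψ, hψ0, hψs, hψeq, ⟨M, fun t _ x => hM t x⟩,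
        fun n => (hψsl n).imp fun A hA t ht => hA t (Ico_subset_Icc_self ht)⟩
    | succ k ih =>
      intro hk
      have hk' : a + (k + 1) * h ≤ b' + 1 := by
        have : (0 : ℝ) ≤ h := hh0.le
        push_cast at hk ⊢; nlinarith
      obtain ⟨ψ, hψ0, hψs, hψeq, ⟨M₁, hM₁⟩, hψsl⟩ := ih hk'
      -- the restart time and the new piece
      set t₀ : ℝ := a + (k + 1) * h with ht₀
      set e₁ : ℝ := a + (k + 2) * h with he₁
      have ht₀a : a < t₀ := by
        rw [ht₀]; have : (0 : ℝ) < (k + 1) * h := by positivity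
        linarith
      have ht₀e : t₀ < e₁ := by rw [ht₀, he₁]; nlinarith
      have he₁' : e₁ = t₀ + h := by rw [ht₀, he₁]; ring
      have hend : a + (↑(k + 1) + 2) * h = t₀ + T := by push_cast; rw [ht₀, hh]; ring
      have ht₀L : t₀ ∈ Icc (-L) L := by
        rw [hL]; push_cast at hk
        constructor <;> nlinarith [abs_nonneg b', neg_abs_le a, le_abs_self a, le_abs_self b',
          neg_abs_le b', hh0]
      have ht₀I : t₀ ∈ Ico a e₁ := ⟨ht₀a.le, ht₀e⟩
      have hdat : ∀ n, ∃ A, IsCkBounded n A (ψ t₀) := fun n => (hψsl n).imp fun A hA => hA t₀ ht₀I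
      obtain ⟨Θ, hΘ0, hΘs, hΘeq, ⟨M₂, hM₂⟩, hΘsl, -⟩ := hstep t₀ ht₀L (ψ t₀) hdat
      -- agreement on the overlap `[t₀, e₁)`
      have hTe : e₁ ≤ t₀ + T := by rw [he₁', hh]; linarith
      obtain ⟨A₁, hA₁⟩ := hψsl 2
      obtain ⟨A₂, hA₂⟩ := hΘsl 2
      have hagree : ∀ t ∈ Ico t₀ e₁, ψ t = Θ t :=
        slices_eq_of_solutions hβb hγb
          (hψs.mono (prod_mono (Ico_subset_Ico_left ht₀a.le) Subset.rfl))
          (hΘs.mono (prod_mono (Ico_subset_Ico_right hTe) Subset.rfl))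
          (fun t ht x => hψeq t ⟨ht₀a.trans ht.1, ht.2⟩ x)
          (fun t ht x => hΘeq t ⟨ht.1, ht.2.trans_le hTe⟩ x)
          (fun t ht x => hM₁ t ⟨ht₀a.le.trans ht.1, ht.2⟩ x) (fun t _ x => hM₂ t x)
          (fun t ht => hA₁ t ⟨ht₀a.le.trans ht.1, ht.2⟩)
          (fun t ht => hA₂ t ⟨ht.1, ht.2.le.trans hTe⟩) hΘ0.symm
      -- the glued function
      set c : ℝ := t₀ + h / 2 with hc
      set ψ' : ℝ → E → ℝ := fun t => if t ≤ c then ψ t else Θ t with hψ'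
      have hψ'_lo : ∀ t, t < e₁ → ψ' t = ψ t := by
        intro t hte
        by_cases htc : t ≤ c
        · simp only [hψ', htc, if_true]
        · simp only [hψ', htc, if_false]
          exact (hagree t ⟨by rw [hc] at htc; push Not at htc; linarith, hte⟩).symm
      have hψ'_hi : ∀ t, t₀ < t → ψ' t = Θ t := by
        intro t htt
        by_cases htc : t ≤ c
        · simp only [hψ', htc, if_true]
          exact hagree t ⟨htt.le, by rw [hc] at htc; linarith⟩
        · simp only [hψ', htc, if_false]
      rw [hend]
      refine ⟨ψ', ?_, ?_, ?_, ?_, ?_⟩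
      · -- initial datum
        rw [hψ'_lo a (ht₀a.trans ht₀e), hψ0]
      · -- joint smoothness, by locality
        refine contDiffOn_of_locally_contDiffOn fun p hp => ?_
        by_cases hp1 : p.1 < e₁
        · refine ⟨Iio e₁ ×ˢ univ, isOpen_Iio.prod isOpen_univ, ⟨hp1, mem_univ _⟩, ?_⟩
          have hset : Ico a (t₀ + T) ×ˢ (univ : Set E) ∩ Iio e₁ ×ˢ univ ⊆ Ico a e₁ ×ˢ univ :=
            fun q hq => ⟨⟨hq.1.1.1, hq.2.1⟩, mem_univ _⟩
          refine (hψs.mono hset).congr fun q hq => ?_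
          simp only [uncurry, hψ'_lo q.1 (hset hq).1.2]
        · push Not at hp1
          have hpt : t₀ < p.1 := ht₀e.trans_le hp1
          refine ⟨Ioi t₀ ×ˢ univ, isOpen_Ioi.prod isOpen_univ, ⟨hpt, mem_univ _⟩, ?_⟩
          have hset : Ico a (t₀ + T) ×ˢ (univ : Set E) ∩ Ioi t₀ ×ˢ univ ⊆ Ico t₀ (t₀ + T) ×ˢ univ :=
            fun q hq => ⟨⟨le_of_lt hq.2.1, hq.1.1.2⟩, mem_univ _⟩
          refine (hΘs.mono hset).congr fun q hq => ?_
          simp only [uncurry, hψ'_hi q.1 hq.2.1]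
      · -- the equation
        intro t ht x
        by_cases ht1 : t < e₁
        · have hev : (fun s => ψ' s x) =ᶠ[𝓝 t] fun s => ψ s x := by
            filter_upwards [Iio_mem_nhds ht1] with s hs using by rw [hψ'_lo s hs]
          rw [hψ'_lo t ht1]
          exact (hψeq t ⟨ht.1, ht1⟩ x).congr_of_eventuallyEq hev
        · push Not at ht1
          have htt : t₀ < t := ht₀e.trans_le ht1
          have hev : (fun s => ψ' s x) =ᶠ[𝓝 t] fun s => Θ s x := by
            filter_upwards [Ioi_mem_nhds htt] with s hs using by rw [hψ'_hi s hs]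
          rw [hψ'_hi t htt]
          exact (hΘeq t ⟨htt, ht.2⟩ x).congr_of_eventuallyEq hev
      · -- boundedness
        refine ⟨max M₁ M₂, fun t ht x => ?_⟩
        by_cases ht1 : t < e₁
        · rw [hψ'_lo t ht1]; exact (hM₁ t ⟨ht.1, ht1⟩ x).trans (le_max_left _ _)
        · push Not at ht1
          rw [hψ'_hi t (ht₀e.trans_le ht1)]; exact (hM₂ t x).trans (le_max_right _ _)
      · -- slices bounded in every `Cⁿ`
        intro n
        obtain ⟨A, hA⟩ := hψsl n
        obtain ⟨A', hA'⟩ := hΘsl n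
        refine ⟨max A A', fun t ht => ?_⟩
        by_cases ht1 : t < e₁
        · rw [hψ'_lo t ht1]
          exact ⟨(hA t ⟨ht.1, ht1⟩).contDiff,
            fun j hj x => ((hA t ⟨ht.1, ht1⟩).norm_le j hj x).trans (le_max_left _ _)⟩
        · push Not at ht1
          have htt : t₀ < t := ht₀e.trans_le ht1
          rw [hψ'_hi t htt]
          exact ⟨(hA' t ⟨htt.le, ht.2.le⟩).contDiff,
            fun j hj x => ((hA' t ⟨htt.le, ht.2.le⟩).norm_le j hj x).trans (le_max_right _ _)⟩
  -- ### the window containing `[a, b')`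
  obtain ⟨N, hN⟩ : ∃ N : ℕ, b' ≤ a + (N + 2) * h ∧ a + (N + 1) * h ≤ b' + 1 := by
    obtain ⟨N, hN1, hN2⟩ : ∃ N : ℕ, (b' - a) / h ≤ N + 2 ∧ (N : ℝ) + 1 < (b' - a) / h + 1 := by
      refine ⟨⌈(b' - a) / h - 2⌉₊, ?_, ?_⟩
      · have := Nat.le_ceil ((b' - a) / h - 2); linarith
      · have hpos : 0 < (b' - a) / h := div_pos (sub_pos.2 hab) hh0
        by_cases hle : (b' - a) / h - 2 ≤ 0
        · rw [Nat.ceil_eq_zero.2 hle]; push_cast; linarith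
        · push Not at hle
          have := Nat.ceil_lt_add_one hle.le; linarith
    refine ⟨N, ?_, ?_⟩
    · rw [div_le_iff₀ hh0] at hN1; linarith
    · have h1 : ((N : ℝ) + 1) * h < ((b' - a) / h + 1) * h := mul_lt_mul_of_pos_right hN2 hh0
      have h2 : ((b' - a) / h + 1) * h = (b' - a) + h := by field_simp
      rw [h2] at h1
      have : h ≤ 1 := by rw [hh]; linarith
      linarith
  obtain ⟨ψ, hψ0, hψs, hψeq, ⟨M, hM⟩, hψsl⟩ := chain N hN.2
  have hsub : Ico a b' ⊆ Ico a (a + (N + 2) * h) := Ico_subset_Ico_right hN.1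
  exact ⟨ψ, hψ0, hψs.mono (prod_mono hsub Subset.rfl), fun t ht x => hψeq t ⟨ht.1, ht.2.trans_le hN.1⟩ x,
    ⟨M, fun t ht x => hM t (hsub ht) x⟩, fun n => (hψsl n).imp fun A hA t ht => hA t (hsub ht)⟩

/-- Anchor (registered sub-stub of stub W2): `linear_global` in closed form. -/
theorem w2aux_linearGlobal : ∀ {E : Type} [NormedAddCommGroup E] [InnerProductSpace ℝ E]
    [FiniteDimensional ℝ E] [MeasurableSpace E] [BorelSpace E] {β : ℝ → E → E} {γ : ℝ → E → ℝ},
    ContDiff ℝ ∞ (uncurry β) → ContDiff ℝ ∞ (uncurry γ) →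
    (∀ n, ∃ C, ∀ p, ‖iteratedFDeriv ℝ n (uncurry β) p‖ ≤ C) →
    (∀ n, ∃ C, ∀ p, ‖iteratedFDeriv ℝ n (uncurry γ) p‖ ≤ C) → ∀ {a b' : ℝ}, a < b' →
    ∀ ψ₀ : E → ℝ, (∀ n, ∃ A, IsCkBounded n A ψ₀) →
    ∃ ψ : ℝ → E → ℝ, ψ a = ψ₀ ∧ ContDiffOn ℝ ∞ (uncurry ψ) (Ico a b' ×ˢ univ) ∧
      (∀ t ∈ Ioo a b', ∀ x, HasDerivAt (fun s => ψ s x)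
        ((Δ (ψ t)) x + fderiv ℝ (ψ t) x (β t x) + γ t x * ψ t x) t) ∧
      (∃ M, ∀ t ∈ Ico a b', ∀ x, |ψ t x| ≤ M) ∧
      (∀ n, ∃ A, ∀ t ∈ Ico a b', IsCkBounded n A (ψ t)) :=
  fun hβ hγ hβb hγb _ _ hab ψ₀ hψ₀ => linear_global hβ hγ hβb hγb hab ψ₀ hψ₀

end Global

end Summit.NavierStokesRegularity.NavierStokesRegularity.Theorems.SelfMixingDichotomy.MixingPayoffBirth

end
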